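import Mathlib
import Summits.ValiantsHypothesis.ValiantsHypothesis.Theorems.BarrierLeverPartitionMinorsHitByVPSimplexJoinTwoDeep

/-!
# Route BarrierLever — item `PartitionMinorsHitByVP` (stmt-ValiantsHypothesis-19717):
# the TWO-DEEP-SLOTS obstruction, RANK FORM (regime B of the tensor-level law for two slots)

Helper file (`--supports stmt-ValiantsHypothesis-19717`; cell valiant-natproofs, rung V4, 𝒟-side door (c), line
`hidden_states`, uniform-menu lane; prover seat val-np-p3 gen 12). Definition-free. Closes NO item. Strengthens
`…SimplexJoinTwoDeep` (p627757): there, ALL rows had to be small; here only MORE THAN `r − x₁·x₂` of them.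

MECHANISM. Fix a piece `p` and slots `f₁ ≠ f₂` of an exact-support design. If slot `f` offers `|S p f|` options, the `|S p f| + 1` option
points satisfy a SPACE of level-`m` moment relations (`Σ_o Λ_o x_o^W = 0` for all `W ⊆ A`, `|W| ≤ m`) of dimension at least
`x_f := |S p f| + 1 − Σ_{i≤m} C(|A|, i)` (rank–nullity, `exists_independent_relations`). Tensors of independent relations are independent
(`tensor_independent`): the `x₁·x₂` vectors `Λ^{(s)} ⊗ Μ^{(t)}`, placed on the sub-grid columns of the piece, are linearly independent
vectors of `ℂ^r` killed by EVERY row `U ⊆ A` of size `≤ 2m+1` (`…TwoDeep.sum_sum_prod_eq_zero_level`). If the row family has MORE THAN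
`r − x₁x₂` such rows, the remaining `< x₁x₂` rows cannot separate these vectors: some nonzero combination lies in the kernel of the whole
`u`-side matrix (`LinearMap.ker_ne_bot_of_finrank_lt`), which is therefore SINGULAR for every table (**`det_eq_zero_of_two_deep_slots_rank`**).

WHY IT MATTERS (memo val-np-p3 g12 §2). This is the regime that bites first: the square of the widest factor, `V_{(2h)²+1}²` (`x = (2h)² + 1 −
(1 + h + C(h,2))` at `m = 2`), is bad against every row family containing more than `((2h)²+1)² − x²` sets of size `≤ 5` — such families of size
`((2h)²+1)²` exist as soon as `C(h,≤5) > ((2h)²+1)² − x²`, i.e. from `h ≈ 500` on (the pure regime A of p627757 needs `h ≥ 1919`). Together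
with the 3-slot count of the memo this is the mechanism of the (T)-GAP above the simplex reach that defeats the uniform simplex menu at large `h`.
Nothing here bears on crux 14610 or VP ≠ VNP; item 19717 stays OPEN.
-/

set_option linter.dupNamespace false

namespace Summit.ValiantsHypothesis.ValiantsHypothesis.Theorems.BarrierLever.SimplexJoin

open Finset Matrix

/-- **Independent moment relations.** The option points indexed by `L` carry at least `|L| − #{W ⊆ A : |W| ≤ m}` LINEARLY
INDEPENDENT level-`m` moment relations (as functions on `L`, extended by `0`). -/
theorem exists_independent_relations (h m : ℕ) (A : Finset (Fin h)) {α : Type*} [DecidableEq α] (L : Finset α)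
    (x : α → Fin h → ℂ) (n : ℕ) (hn : n + (A.powerset.filter (fun W => W.card ≤ m)).card ≤ L.card) :
    ∃ Λ : Fin n → α → ℂ,
      (∀ s, ∀ W, W ⊆ A → W.card ≤ m → ∑ o ∈ L, Λ s o * ∏ a ∈ W, x o a = 0) ∧
      (∀ s o, o ∉ L → Λ s o = 0) ∧
      LinearIndependent ℂ (fun s => fun o : L => Λ s o) := by
  classical
  set Sm := A.powerset.filter (fun W => W.card ≤ m) with hSm
  -- the moment map on functions on `L`
  let Φ : (L → ℂ) →ₗ[ℂ] (Sm → ℂ) :=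
    { toFun := fun g W => ∑ o : L, g o * ∏ a ∈ (W : Finset (Fin h)), x o a
      map_add' := by
        intro g g'; funext W; simp only [Pi.add_apply]; rw [← Finset.sum_add_distrib]
        exact Finset.sum_congr rfl fun o _ => by ring
      map_smul' := by
        intro c g; funext W; simp only [Pi.smul_apply, smul_eq_mul, RingHom.id_apply]; rw [Finset.mul_sum]
        exact Finset.sum_congr rfl fun o _ => by ring }
  have hker : n ≤ Module.finrank ℂ (LinearMap.ker Φ) := by
    have h1 := LinearMap.finrank_range_add_finrank_ker Φ
    have h2 : Module.finrank ℂ (LinearMap.range Φ) ≤ Module.finrank ℂ (Sm → ℂ) := Submodule.finrank_le _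
    rw [Module.finrank_fintype_fun_eq_card, Fintype.card_coe] at h2
    rw [Module.finrank_fintype_fun_eq_card, Fintype.card_coe] at h1
    omega
  let b := Module.finBasis ℂ (LinearMap.ker Φ)
  let g : Fin n → (L → ℂ) := fun s => ((b (Fin.castLE hker s) : LinearMap.ker Φ) : L → ℂ)
  have hg_li : LinearIndependent ℂ g := by
    have h1 : LinearIndependent ℂ (fun s : Fin n => b (Fin.castLE hker s)) :=
      b.linearIndependent.comp _ (Fin.castLE_injective hker)
    exact h1.map' (LinearMap.ker Φ).subtype (Submodule.ker_subtype _)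
  have hg_ker : ∀ s, Φ (g s) = 0 := fun s => (b (Fin.castLE hker s)).2
  refine ⟨fun s o => if ho : o ∈ L then g s ⟨o, ho⟩ else 0, ?_, ?_, ?_⟩
  · intro s W hWA hWm
    have hW : W ∈ Sm := (mem_filter_powerset_card_le A m W).mpr ⟨hWA, hWm⟩
    have h1 := congrFun (hg_ker s) ⟨W, hW⟩
    simp only [Φ, LinearMap.coe_mk, AddHom.coe_mk, Pi.zero_apply] at h1
    rw [← Finset.sum_coe_sort L]
    convert h1 using 2 with o
    simp [o.2]
  · intro s o ho; simp [ho]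
  · convert hg_li using 2 with s
    funext o; simp [o.2, g]

/-- **Tensors of independent families are independent** (evaluated on a product grid). -/
theorem tensor_independent {α β : Type*} (L₁ : Finset α) (L₂ : Finset β) {n₁ n₂ : ℕ}
    (Λ : Fin n₁ → α → ℂ) (Μ : Fin n₂ → β → ℂ)
    (hΛ : LinearIndependent ℂ (fun s => fun o : L₁ => Λ s o))
    (hΜ : LinearIndependent ℂ (fun t => fun o : L₂ => Μ t o))
    (c : Fin n₁ × Fin n₂ → ℂ)
    (hc : ∀ o ∈ L₁, ∀ o' ∈ L₂, ∑ st : Fin n₁ × Fin n₂, c st * (Λ st.1 o * Μ st.2 o') = 0) :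
    c = 0 := by
  classical
  rw [Fintype.linearIndependent_iff] at hΛ hΜ
  -- first: for each `o' ∈ L₂` and `s`, `Σ_t c (s,t) Μ t o' = 0`
  have step1 : ∀ o' ∈ L₂, ∀ s, ∑ t, c (s, t) * Μ t o' = 0 := by
    intro o' ho' 
    refine hΛ (fun s => ∑ t, c (s, t) * Μ t o') ?_
    funext o
    simp only [Finset.sum_apply, Pi.smul_apply, smul_eq_mul, Pi.zero_apply]
    have := hc o o.2 o' ho'
    rw [← Finset.univ_product_univ, Finset.sum_product] at this
    rw [← this]
    refine Finset.sum_congr rfl fun s _ => ?_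
    rw [Finset.sum_mul]
    exact Finset.sum_congr rfl fun t _ => by ring
  funext st
  obtain ⟨s, t⟩ := st
  have step2 := hΜ (fun t => c (s, t)) (by
    funext o'
    simp only [Finset.sum_apply, Pi.smul_apply, smul_eq_mul, Pi.zero_apply]
    exact step1 o' o'.2 s)
  exact step2 t

/-- **THE TWO-DEEP-SLOTS OBSTRUCTION, RANK FORM.** In the exact-support door, let the design `e` (injective, exactly the live
columns of `S`) have a piece `p` and slots `f₁ ≠ f₂`, and put `x_f := |S p f| + 1 − Σ_{i ≤ m} C(|A|, i)`. If the row family `u`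
has MORE THAN `r − x₁·x₂` members inside `A` of size `≤ 2m + 1`, then for EVERY table the `u`-side matrix of the design is singular. -/
theorem det_eq_zero_of_two_deep_slots_rank (h mm M D N r : ℕ) (A : Finset (Fin h)) (u : Fin r → Finset (Fin h))
    (S : Fin M → Fin D → Finset (Fin N))
    (e : Fin r → Fin M × (Fin D → Option (Fin N))) (he : Function.Injective e)
    (hlive : ∀ c : Fin M × (Fin D → Option (Fin N)),
      c ∈ Set.range e ↔ ∀ (f : Fin D) (j : Fin N), c.2 f = some j → j ∈ S c.1 f)
    (p : Fin M) (f₁ f₂ : Fin D) (hf : f₁ ≠ f₂)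
    (hrows : r < (Finset.univ.filter fun i => u i ⊆ A ∧ (u i).card ≤ 2 * mm + 1).card +
      ((S p f₁).card + 1 - ∑ i ∈ Finset.range (mm + 1), A.card.choose i) *
      ((S p f₂).card + 1 - ∑ i ∈ Finset.range (mm + 1), A.card.choose i))
    (T : Fin M → Option (Fin D × Fin N) → Fin h → ℂ) :
    (Matrix.of fun i k : Fin r => ∏ a ∈ u i,
      (T (e k).1 none a + ∑ f : Fin D, ((e k).2 f).elim 0 fun j => T (e k).1 (some (f, j)) a)).det = 0 := by
  classical
  set Sm := ∑ i ∈ Finset.range (mm + 1), A.card.choose i with hSmdef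
  set x₁ := (S p f₁).card + 1 - Sm with hx₁
  set x₂ := (S p f₂).card + 1 - Sm with hx₂
  set Small := Finset.univ.filter (fun i => u i ⊆ A ∧ (u i).card ≤ 2 * mm + 1) with hSmall
  -- trivial case: no relations needed is impossible since r < |Small| + x₁x₂ and |Small| ≤ r
  have hSmall_le : Small.card ≤ r := (Finset.card_filter_le _ _).trans (by simp)
  have hx : 0 < x₁ * x₂ := by
    rcases Nat.eq_zero_or_pos (x₁ * x₂) with h0 | h0
    · rw [h0] at hrows; omega
    · exact h0
  have hx₁ : 0 < x₁ := Nat.pos_of_ne_zero fun h' => by rw [h'] at hx; simp at hx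
  have hx₂ : 0 < x₂ := Nat.pos_of_ne_zero fun h' => by rw [h'] at hx; simp at hx
  -- the two option families and their independent relations
  set L₁ : Finset (Option (Fin N)) := Finset.insertNone (S p f₁) with hL₁
  set L₂ : Finset (Option (Fin N)) := Finset.insertNone (S p f₂) with hL₂
  let x : Option (Fin N) → Fin h → ℂ := fun o a => o.elim 0 fun j => T p (some (f₁, j)) a
  let y : Option (Fin N) → Fin h → ℂ := fun o a => o.elim 0 fun j => T p (some (f₂, j)) a
  have hSmcard := card_filter_powerset_card_le A mm
  have hn₁ : x₁ + (A.powerset.filter (fun W => W.card ≤ mm)).card ≤ L₁.card := by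
    rw [hSmcard, hL₁, Finset.card_insertNone]; omega
  have hn₂ : x₂ + (A.powerset.filter (fun W => W.card ≤ mm)).card ≤ L₂.card := by
    rw [hSmcard, hL₂, Finset.card_insertNone]; omega
  obtain ⟨Λ, hl, hl0, hlI⟩ := exists_independent_relations h mm A L₁ x x₁ hn₁
  obtain ⟨Μ, hm, hm0, hmI⟩ := exists_independent_relations h mm A L₂ y x₂ hn₂
  -- the sub-grid (verbatim from `…TwoDeep`)
  let pat : Option (Fin N) → Option (Fin N) → (Fin D → Option (Fin N)) :=
    fun o o' f => if f = f₁ then o else if f = f₂ then o' else none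
  have hpat₁ : ∀ o o', pat o o' f₁ = o := fun o o' => by simp [pat]
  have hpat₂ : ∀ o o', pat o o' f₂ = o' := fun o o' => by simp [pat, hf.symm]
  have hpat₃ : ∀ o o' f, f ≠ f₁ → f ≠ f₂ → pat o o' f = none := fun o o' f h1 h2 => by simp [pat, h1, h2]
  have hlivepat : ∀ o ∈ L₁, ∀ o' ∈ L₂, (p, pat o o') ∈ Set.range e := by
    intro o ho o' ho'
    rw [hlive]
    intro f j hfj
    change pat o o' f = some j at hfj
    change j ∈ S p f
    by_cases h1 : f = f₁
    · rw [h1, hpat₁] at hfj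
      rw [h1]
      exact Finset.mem_insertNone.mp ho j (by rw [hfj]; rfl)
    · by_cases h2 : f = f₂
      · rw [h2, hpat₂] at hfj
        rw [h2]
        exact Finset.mem_insertNone.mp ho' j (by rw [hfj]; rfl)
      · rw [hpat₃ o o' f h1 h2] at hfj; exact absurd hfj (by simp)
  let InGrid : Fin r → Prop := fun k => (e k).1 = p ∧ ∀ f, f ≠ f₁ → f ≠ f₂ → (e k).2 f = none
  have hgrid₁ : ∀ k, InGrid k → (e k).2 f₁ ∈ L₁ := by
    intro k hk
    rw [hL₁, Finset.mem_insertNone]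
    intro j hj
    have := ((hlive (e k)).mp ⟨k, rfl⟩) f₁ j hj
    rw [hk.1] at this; exact this
  have hgrid₂ : ∀ k, InGrid k → (e k).2 f₂ ∈ L₂ := by
    intro k hk
    rw [hL₂, Finset.mem_insertNone]
    intro j hj
    have := ((hlive (e k)).mp ⟨k, rfl⟩) f₂ j hj
    rw [hk.1] at this; exact this
  have hgridpat : ∀ k, InGrid k → e k = (p, pat ((e k).2 f₁) ((e k).2 f₂)) := by
    intro k hk
    refine Prod.ext hk.1 (funext fun f => ?_)
    change (e k).2 f = pat ((e k).2 f₁) ((e k).2 f₂) f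
    by_cases h1 : f = f₁
    · rw [h1, hpat₁]
    · by_cases h2 : f = f₂
      · rw [h2, hpat₂]
      · rw [hpat₃ _ _ f h1 h2]; exact hk.2 f h1 h2
  have hkOf : ∀ oo : Option (Fin N) × Option (Fin N), oo ∈ L₁ ×ˢ L₂ → ∃ k, e k = (p, pat oo.1 oo.2) := by
    intro oo hoo
    obtain ⟨ho, ho'⟩ := Finset.mem_product.mp hoo
    obtain ⟨k, hk⟩ := hlivepat oo.1 ho oo.2 ho'
    exact ⟨k, hk⟩
  have hne₁ : (none : Option (Fin N)) ∈ L₁ := by rw [hL₁]; exact Finset.none_mem_insertNone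
  have hne₂ : (none : Option (Fin N)) ∈ L₂ := by rw [hL₂]; exact Finset.none_mem_insertNone
  let kOf : Option (Fin N) × Option (Fin N) → Fin r := fun oo =>
    if hoo : oo ∈ L₁ ×ˢ L₂ then (hkOf oo hoo).choose else ⟨0, by
      have : 0 < r := Fin.pos (hkOf (none, none) (Finset.mem_product.mpr ⟨hne₁, hne₂⟩)).choose
      exact this⟩
  have hkOf_spec : ∀ oo ∈ L₁ ×ˢ L₂, e (kOf oo) = (p, pat oo.1 oo.2) := by
    intro oo hoo
    simp only [kOf, dif_pos hoo]
    exact (hkOf oo hoo).choose_spec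
  have hkOf_grid : ∀ oo ∈ L₁ ×ˢ L₂, InGrid (kOf oo) := by
    intro oo hoo
    refine ⟨by rw [hkOf_spec oo hoo], fun f h1 h2 => ?_⟩
    rw [hkOf_spec oo hoo]
    exact hpat₃ _ _ f h1 h2
  have hpoint : ∀ k, InGrid k → ∀ a, T (e k).1 none a + ∑ f : Fin D, ((e k).2 f).elim 0 (fun j => T (e k).1 (some (f, j)) a) =
      T p none a + x ((e k).2 f₁) a + y ((e k).2 f₂) a := by
    intro k hk a
    rw [hk.1, Fintype.sum_eq_add f₁ f₂ hf]
    · simp only [x, y, add_assoc]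
    · intro f hff
      rw [hk.2 f hff.1 hff.2]; rfl
  -- the matrix and the kernel vectors `v st`
  set Mx : Matrix (Fin r) (Fin r) ℂ := Matrix.of fun i k : Fin r => ∏ a ∈ u i,
      (T (e k).1 none a + ∑ f : Fin D, ((e k).2 f).elim 0 fun j => T (e k).1 (some (f, j)) a) with hMx
  let v : Fin x₁ × Fin x₂ → Fin r → ℂ := fun st k =>
    if InGrid k then Λ st.1 ((e k).2 f₁) * Μ st.2 ((e k).2 f₂) else 0
  -- (i) every small row kills every `v st`
  have hsmall : ∀ i, (u i ⊆ A ∧ (u i).card ≤ 2 * mm + 1) → ∀ st, ∑ k, Mx i k * v st k = 0 := by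
    intro i hi st
    calc ∑ k, Mx i k * v st k
        = ∑ k ∈ Finset.univ.filter InGrid, Λ st.1 ((e k).2 f₁) * Μ st.2 ((e k).2 f₂) *
            ∏ a ∈ u i, (T p none a + x ((e k).2 f₁) a + y ((e k).2 f₂) a) := by
          rw [Finset.sum_filter]
          refine Finset.sum_congr rfl fun k _ => ?_
          by_cases hk : InGrid k
          · have hv' : v st k = Λ st.1 ((e k).2 f₁) * Μ st.2 ((e k).2 f₂) := if_pos hk
            rw [if_pos hk, hv', hMx, Matrix.of_apply, Finset.prod_congr rfl fun a _ => hpoint k hk a]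
            ring
          · have hv' : v st k = 0 := if_neg hk
            rw [if_neg hk, hv', mul_zero]
      _ = ∑ oo ∈ L₁ ×ˢ L₂, Λ st.1 oo.1 * Μ st.2 oo.2 * ∏ a ∈ u i, (T p none a + x oo.1 a + y oo.2 a) := by
          refine Finset.sum_nbij' (fun k => ((e k).2 f₁, (e k).2 f₂)) kOf ?_ ?_ ?_ ?_ ?_
          · intro k hk
            have hk' := (Finset.mem_filter.mp hk).2
            exact Finset.mem_product.mpr ⟨hgrid₁ k hk', hgrid₂ k hk'⟩
          · intro oo hoo
            exact Finset.mem_filter.mpr ⟨Finset.mem_univ _, hkOf_grid oo hoo⟩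
          · intro k hk
            have hk' := (Finset.mem_filter.mp hk).2
            have hoo : ((e k).2 f₁, (e k).2 f₂) ∈ L₁ ×ˢ L₂ := Finset.mem_product.mpr ⟨hgrid₁ k hk', hgrid₂ k hk'⟩
            apply he
            rw [hkOf_spec _ hoo, ← hgridpat k hk']
          · intro oo hoo
            refine Prod.ext ?_ ?_
            · show (e (kOf oo)).2 f₁ = oo.1
              rw [hkOf_spec oo hoo]; exact hpat₁ _ _
            · show (e (kOf oo)).2 f₂ = oo.2
              rw [hkOf_spec oo hoo]; exact hpat₂ _ _
          · intro k _; rfl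
      _ = ∑ o ∈ L₁, ∑ o' ∈ L₂, Λ st.1 o * Μ st.2 o' * ∏ a ∈ u i, (T p none a + x o a + y o' a) :=
          Finset.sum_product _ _ _
      _ = 0 := sum_sum_prod_eq_zero_level A L₁ L₂ (Λ st.1) (Μ st.2) x y (fun a => T p none a)
            (hl st.1) (hm st.2) (u i) hi.1 hi.2
  -- (ii) the `v st` are linearly independent
  have hvI : ∀ c : Fin x₁ × Fin x₂ → ℂ, (∑ st, c st • v st = 0) → c = 0 := by
    intro c hc
    refine tensor_independent L₁ L₂ Λ Μ hlI hmI c fun o ho o' ho' => ?_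
    have hoo : (o, o') ∈ L₁ ×ˢ L₂ := Finset.mem_product.mpr ⟨ho, ho'⟩
    have h1 := congrFun hc (kOf (o, o'))
    simp only [Finset.sum_apply, Pi.smul_apply, smul_eq_mul, Pi.zero_apply] at h1
    rw [← h1]
    refine Finset.sum_congr rfl fun st _ => ?_
    have hv' : v st (kOf (o, o')) = Λ st.1 ((e (kOf (o, o'))).2 f₁) * Μ st.2 ((e (kOf (o, o'))).2 f₂) :=
      if_pos (hkOf_grid _ hoo)
    rw [hv', hkOf_spec _ hoo]
    change c st * (Λ st.1 o * Μ st.2 o') = c st * (Λ st.1 (pat o o' f₁) * Μ st.2 (pat o o' f₂))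
    rw [hpat₁, hpat₂]
  -- (iii) the big rows are too few to separate them
  let Big := {i : Fin r // ¬ (u i ⊆ A ∧ (u i).card ≤ 2 * mm + 1)}
  have hBig : Fintype.card Big < x₁ * x₂ := by
    have h1 : Fintype.card Big = r - Small.card := by
      rw [Fintype.card_subtype_compl, Fintype.card_fin]
      congr 1
      rw [hSmall, Fintype.card_subtype]
    rw [h1]; omega
  let Ψ : (Fin x₁ × Fin x₂ → ℂ) →ₗ[ℂ] (Big → ℂ) :=
    { toFun := fun c i => ∑ st, c st * ∑ k, Mx i.1 k * v st k
      map_add' := by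
        intro c c'; funext i; simp only [Pi.add_apply]; rw [← Finset.sum_add_distrib]
        exact Finset.sum_congr rfl fun st _ => by ring
      map_smul' := by
        intro a c; funext i; simp only [Pi.smul_apply, smul_eq_mul, RingHom.id_apply]; rw [Finset.mul_sum]
        exact Finset.sum_congr rfl fun st _ => by ring }
  have hΨ : LinearMap.ker Ψ ≠ ⊥ := by
    apply LinearMap.ker_ne_bot_of_finrank_lt
    rw [Module.finrank_fintype_fun_eq_card, Module.finrank_fintype_fun_eq_card, Fintype.card_prod, Fintype.card_fin,
      Fintype.card_fin]
    exact hBig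
  obtain ⟨c, hcker, hc0⟩ := (Submodule.ne_bot_iff _).mp hΨ
  -- the kernel vector of the whole matrix
  let w : Fin r → ℂ := fun k => ∑ st, c st * v st k
  have hw : w ≠ 0 := by
    intro hw
    apply hc0
    apply hvI c
    funext k
    simp only [Finset.sum_apply, Pi.smul_apply, smul_eq_mul, Pi.zero_apply]
    exact congrFun hw k
  apply (Matrix.exists_mulVec_eq_zero_iff).mp
  refine ⟨w, hw, funext fun i => ?_⟩
  simp only [Matrix.mulVec, dotProduct, Pi.zero_apply]
  have hrew : ∑ k, Mx i k * w k = ∑ st, c st * ∑ k, Mx i k * v st k := by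
    simp only [w, Finset.mul_sum]
    rw [Finset.sum_comm]
    exact Finset.sum_congr rfl fun st _ => Finset.sum_congr rfl fun k _ => by ring
  rw [hrew]
  by_cases hi : u i ⊆ A ∧ (u i).card ≤ 2 * mm + 1
  · exact Finset.sum_eq_zero fun st _ => by rw [hsmall i hi st, mul_zero]
  · have := congrFun (LinearMap.mem_ker.mp hcker) ⟨i, hi⟩
    simpa [Ψ] using this

end Summit.ValiantsHypothesis.ValiantsHypothesis.Theorems.BarrierLever.SimplexJoin
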